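import Literature.Computability.Complexity.Promise
import Literature.Computability.Complexity.PRelHierarchy
import Literature.Computability.Complexity.BranchingFn
import Literature.Computability.Complexity.IterateFP
import Literature.Computability.Complexity.MajorityVote
import Literature.Computability.Complexity.UniformProbBlocks
import Literature.Computability.Complexity.CountingHierarchyProofs
import Literature.Computability.Complexity.CountingHierarchyPPoly
import HarnessLib

/-!
# Error reduction for promise-BPP (Goldreich 2006, Def. 2; Arora–Barak 2009, §7.4.1)

Trunk `CplxCore`, toolkit for `Promise.lean` / `PromiseCookReductions.lean`. For the textbook
class promise-BPP (`PromiseBPP'`: a witness language `L' ∈ P` and a coin polynomial `p`, with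
acceptance probability `≥ 2/3` on YES instances and `≤ 1/3` on NO instances, nothing required
off the promise) we prove **error reduction to any inverse polynomial**:

* `PromiseProblem.exists_amplifier_of_mem_PromiseBPP'`: for `Q ∈ PromiseBPP'` and every
  polynomial `r` there are `L'' ∈ P` and a coin polynomial `p''` such that for `x ∈ Q.yes` the
  fraction of coin strings `y ∈ {0,1}^{p''(|x|)}` with `⟨x, y⟩ ∉ L''` is `≤ 1/(r(|x|) + 1)`, for
  `x ∈ Q.no` the fraction with `⟨x, y⟩ ∈ L''` is `≤ 1/(r(|x|) + 1)`, and membership of `⟨x, y⟩`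
  in `L''` depends only on the first `p''(|x|)` coins.

This is the standard majority vote over independent runs (Arora–Barak 2009, §7.4.1 and
Thm. 7.10: "run `M(x)` `k` times … output the majority answer"; Goldreich 2006, §1.2, Def. 2
BPP bullet, where the constant `2/3` "can be replaced" by `1 - ν(|x|)`), here with Chebyshev's
inequality in place of the Chernoff bound: `K(n) = 18 r(n) + 19` votes suffice for error
`1/(r(n) + 1)` (`card_majority_fail_le` of `MajorityVote.lean`, `η = 1/6`).

**The machine** (no Turing machine is written; the tree's `FP` algebra): on `⟨x, y⟩` lay out the
state `⟨x, ⟨y ↾ (K+1), y⟩⟩` (the counter is a string of LENGTH `K + 1`, its bits irrelevant) and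
iterate `K(|x|)` times (`iterate_mem_FP`) the round `⟨x, ⟨d, c⟩⟩ ↦ ⟨x, ⟨d', c ⇂ p(|x|)⟩⟩` with
`d' = d ⇂ 2` if the decider of `L'` accepts `⟨x, c ↾ p(|x|)⟩` and `d' = d` otherwise
(`truncSndFn`, `dropSndFn`, `indicatorFn_mem_FP`, `iteFn`, `pairFn`); accept iff the counter is
exhausted (`IsNil`), i.e. iff `2 · #accepting blocks ≥ K + 1` (`boolPair_mem_ampLang_iff`).

**The probability** (`uniformProb_ampLang_compl_le`, `uniformProb_ampLang_le`): the event
depends on the first `K p(|x|)` coins (`uniformProb_take_of_le`); over `{0,1}^{K p}` counted as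
`Fin K → (Fin p → Bool)` (`Equiv.curry` after `finProdFinEquiv`) it is the failure of a strict
majority of good blocks, of probability `≤ 1/(r+1)` by `card_majority_fail_le` since each block is
good with probability `≥ 2/3 = 1/2 + 1/6` and `K ≥ 9 (r + 1)`.

## References

* O. Goldreich, *On promise problems: a survey*, LNCS 3895 (2006) 254–290, §1.2 Def. 2 (BPP as
  a class of promise problems) [Goldreich2006].
* S. Arora, B. Barak, *Computational Complexity: A Modern Approach*, CUP 2009, §7.4.1 and
  Thm. 7.10 (error reduction by majority vote), Def. 7.3 (random-string form), §A.2 (Chebyshev)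
  [AroraBarak2009].
* M. Sipser, *Introduction to the Theory of Computation*, 3rd ed., Lemma 10.5 (amplification).
-/

noncomputable section

namespace Literature.Computability.Complexity

open _root_.Computability Polynomial Finset PRelSigma

open scoped Classical

namespace PromiseAmp

variable (L' : Language Bool) (p r : Polynomial ℕ)

/-! ### Parameters -/

/-- The number of votes `K = 18 r + 19` (odd, and `≥ 9 (r + 1)` as Chebyshev requires for
`η = 1/6`, `δ = 1/(r+1)`). [cite: AroraBarak2009, §7.4.1] -/
def votes : Polynomial ℕ := 18 * r + 19

/-- Evaluation of `votes`. [folklore] -/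
@[simp] theorem votes_eval (n : ℕ) : (votes r).eval n = 18 * r.eval n + 19 := by
  simp [votes]

/-- The coin polynomial of the amplifier: `K p + K + 1` (room for `K` blocks of `p` coins and a
counter of length `K + 1`). [cite: AroraBarak2009, §7.4.1] -/
def coins : Polynomial ℕ := votes r * p + votes r + 1

/-- Evaluation of `coins`. [folklore] -/
@[simp] theorem coins_eval (n : ℕ) :
    (coins p r).eval n = (18 * r.eval n + 19) * p.eval n + (18 * r.eval n + 19) + 1 := by
  simp [coins]

/-! ### The round function and the amplified language -/

/-- Accessor: the instance `x` of a state `⟨x, ⟨d, c⟩⟩`. [folklore] -/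
def xW : List Bool → List Bool := fstP
/-- Accessor: the counter `d`. [folklore] -/
def dW : List Bool → List Bool := fstP ∘ sndP
/-- Accessor: the remaining coins `c`. [folklore] -/
def cW : List Bool → List Bool := sndP ∘ sndP

/-- The vote of the current block: `[⟨x, c ↾ p(|x|)⟩ ∈ L']`. [cite: AroraBarak2009, §7.4.1] -/
def voteW : List Bool → List Bool :=
  (fun w => encodeBool (L'.boolIndicator w)) ∘ truncSndFn p ∘ pairFn xW cW

/-- The remaining coins after the current block. [folklore] -/
def restW : List Bool → List Bool := sndP ∘ dropSndFn p ∘ pairFn xW cW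

/-- The new counter: two units less on an accepting vote. [folklore] -/
def dNew : List Bool → List Bool := iteFn (voteW L' p) (List.tail ∘ List.tail ∘ dW) dW

/-- **The round**: `⟨x, ⟨d, c⟩⟩ ↦ ⟨x, ⟨d', c ⇂ p(|x|)⟩⟩`. [cite: AroraBarak2009, §7.4.1] -/
def roundFn : List Bool → List Bool := pairFn xW (pairFn (dNew L' p) (restW p))

/-- `K(|x|)` rounds. [cite: AroraBarak2009, §7.4.1] -/
def iterFn (z : List Bool) : List Bool := (roundFn L' p)^[(votes r).eval (boolUnpair z).1.length] z

/-- The initial state `⟨x, ⟨y ↾ (K+1), y⟩⟩` of `⟨x, y⟩`. [folklore] -/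
def initW : List Bool → List Bool := pairFn fstP (pairFn (sndP ∘ truncSndFn (votes r + 1)) sndP)

/-- **The amplified witness language**: the counter is exhausted after `K` rounds.
[cite: AroraBarak2009, §7.4.1] -/
def ampLang : Language Bool := (dW ∘ iterFn L' p r ∘ initW r) ⁻¹' IsNil

/-! ### Polynomial time -/

/-- The accessors are in `FP`. [folklore] -/
theorem xW_mem_FP : xW ∈ FP := fstP_mem_FP
/-- The accessors are in `FP`. [folklore] -/
theorem dW_mem_FP : dW ∈ FP := comp_mem_FP fstP_mem_FP sndP_mem_FP
/-- The accessors are in `FP`. [folklore] -/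
theorem cW_mem_FP : cW ∈ FP := comp_mem_FP sndP_mem_FP sndP_mem_FP

variable {L'}

/-- The vote is in `FP` for `L' ∈ P`. [cite: AroraBarak2009, §1.3] -/
theorem voteW_mem_FP (hL' : L' ∈ Classes.P) : voteW L' p ∈ FP :=
  comp_mem_FP (indicatorFn_mem_FP hL') (comp_mem_FP (truncSndFn_mem_FP p) (pairFn_mem_FP xW_mem_FP cW_mem_FP))

/-- The rest map is in `FP`. [folklore] -/
theorem restW_mem_FP : restW p ∈ FP :=
  comp_mem_FP sndP_mem_FP (comp_mem_FP (dropSndFn_mem_FP p) (pairFn_mem_FP xW_mem_FP cW_mem_FP))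

/-- The new counter is in `FP`. [folklore] -/
theorem dNew_mem_FP (hL' : L' ∈ Classes.P) : dNew L' p ∈ FP :=
  iteFn_mem_FP (voteW_mem_FP p hL') (comp_mem_FP tail_mem_FP (comp_mem_FP tail_mem_FP dW_mem_FP)) dW_mem_FP

/-- The round is in `FP`. [cite: AroraBarak2009, §1.3] -/
theorem roundFn_mem_FP (hL' : L' ∈ Classes.P) : roundFn L' p ∈ FP :=
  pairFn_mem_FP xW_mem_FP (pairFn_mem_FP (dNew_mem_FP p hL') (restW_mem_FP p))

/-- The initial layout is in `FP`. [folklore] -/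
theorem initW_mem_FP : initW r ∈ FP :=
  pairFn_mem_FP fstP_mem_FP (pairFn_mem_FP (comp_mem_FP sndP_mem_FP (truncSndFn_mem_FP _)) sndP_mem_FP)

/-! ### Semantics of one round -/

/-- The vote is one bit. [folklore] -/
theorem voteW_eq (w : List Bool) :
    voteW L' p w = [L'.boolIndicator (boolPair (xW w) ((cW w).take (p.eval (xW w).length)))] := by
  simp [voteW, truncSndFn_boolPair, encodeBool]

/-- The rest map drops one block. [folklore] -/
theorem restW_eq (w : List Bool) : restW p w = (cW w).drop (p.eval (xW w).length) := by
  simp [restW, dropSndFn_boolPair]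

/-- The new counter. [folklore] -/
theorem dNew_eq (w : List Bool) :
    dNew L' p w = if boolPair (xW w) ((cW w).take (p.eval (xW w).length)) ∈ L' then (dW w).drop 2 else dW w := by
  rw [dNew, iteFn_apply (voteW_eq p w)]
  by_cases h : boolPair (xW w) ((cW w).take (p.eval (xW w).length)) ∈ L'
  · rw [(Set.mem_iff_boolIndicator _ _).1 h, if_pos rfl, if_pos h]
    simp only [Function.comp_apply]
    rcases dW w with _ | ⟨a, _ | ⟨b, l⟩⟩ <;> rfl
  · rw [(Set.notMem_iff_boolIndicator _ _).1 h, if_neg (by simp), if_neg h]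

/-- **One round on a state.** [cite: AroraBarak2009, §7.4.1] -/
theorem roundFn_boolPair (x d c : List Bool) :
    roundFn L' p (boolPair x (boolPair d c)) =
      boolPair x (boolPair (if boolPair x (c.take (p.eval x.length)) ∈ L' then d.drop 2 else d)
        (c.drop (p.eval x.length))) := by
  simp [roundFn, dNew_eq, restW_eq, xW, dW, cW, fstP, sndP]

/-- The round never grows the state by more than `4` symbols (on every string). [folklore] -/
theorem length_roundFn_le (w : List Bool) : (roundFn L' p w).length ≤ w.length + 4 := by
  have h1 := length_boolUnpair_parts_le w
  have h2 := length_boolUnpair_parts_le (boolUnpair w).2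
  have hd : (dNew L' p w).length ≤ (dW w).length := by
    rw [dNew_eq]; split_ifs <;> simp
  have hr : (restW p w).length ≤ (cW w).length := by rw [restW_eq]; simp
  simp only [roundFn, pairFn_apply, length_boolPair]
  simp only [xW, dW, cW, fstP, sndP, Function.comp_apply] at hd hr ⊢
  omega

/-- `iterFn ∈ FP`. [cite: AroraBarak2009, §7.4.1 with §1.3] -/
theorem iterFn_mem_FP (hL' : L' ∈ Classes.P) : iterFn L' p r ∈ FP :=
  iterate_mem_FP (roundFn_mem_FP p hL') 4 (length_roundFn_le p) (votes r)

/-- **The amplified language is in `P`.** [cite: AroraBarak2009, §7.4.1] -/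
theorem ampLang_mem_P (hL' : L' ∈ Classes.P) : ampLang L' p r ∈ Classes.P :=
  preimage_mem_P IsNil_mem_P (comp_mem_FP dW_mem_FP (comp_mem_FP (iterFn_mem_FP p r hL') (initW_mem_FP r)))

/-! ### Semantics of the iteration -/

variable (L')

/-- The number of accepting votes among the first `i` blocks of `c` (blocks of length `p(|x|)`).
[cite: AroraBarak2009, §7.4.1] -/
def yesCount (x c : List Bool) (i : ℕ) : ℕ :=
  ((range i).filter fun j => boolPair x ((c.drop (j * p.eval x.length)).take (p.eval x.length)) ∈ L').card

variable {L'}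

/-- `yesCount` one block further. [folklore] -/
theorem yesCount_succ (x c : List Bool) (i : ℕ) :
    yesCount L' p x c (i + 1) = yesCount L' p x c i +
      (if boolPair x ((c.drop (i * p.eval x.length)).take (p.eval x.length)) ∈ L' then 1 else 0) := by
  rw [yesCount, yesCount, Finset.range_add_one, filter_insert]
  split_ifs with h
  · rw [card_insert_of_notMem (by simp)]
  · rfl

/-- **The iterated round**: after `i` rounds the counter has lost `2 · yesCount i` units and `i`
blocks of coins are consumed. [cite: AroraBarak2009, §7.4.1] -/
theorem iterate_roundFn (x d c : List Bool) (i : ℕ) :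
    (roundFn L' p)^[i] (boolPair x (boolPair d c)) =
      boolPair x (boolPair (d.drop (2 * yesCount L' p x c i)) (c.drop (i * p.eval x.length))) := by
  induction i with
  | zero => simp [yesCount]
  | succ i ih =>
    rw [Function.iterate_succ_apply', ih, roundFn_boolPair, yesCount_succ,
      show (i + 1) * p.eval x.length = i * p.eval x.length + p.eval x.length by ring]
    split_ifs with h
    · rw [List.drop_drop, List.drop_drop, show 2 * (yesCount L' p x c i + 1) = 2 * yesCount L' p x c i + 2 by ring]
    · rw [List.drop_drop, Nat.add_zero]

/-! ### Membership in the amplified language -/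

/-- The initial layout of a pair. [folklore] -/
theorem initW_boolPair (x y : List Bool) :
    initW r (boolPair x y) = boolPair x (boolPair (y.take ((votes r).eval x.length + 1)) y) := by
  simp [initW, truncSndFn_boolPair, fstP, sndP]

/-- **Membership of `⟨x, y⟩` in the amplified language**: the counter `y ↾ (K+1)` loses
`2 · yesCount K` units and must be exhausted. [cite: AroraBarak2009, §7.4.1] -/
theorem boolPair_mem_ampLang_iff (x y : List Bool) :
    boolPair x y ∈ ampLang L' p r ↔
      (y.take ((votes r).eval x.length + 1)).drop (2 * yesCount L' p x y ((votes r).eval x.length)) = [] := by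
  change (dW (iterFn L' p r (initW r (boolPair x y)))) ∈ IsNil ↔ _
  rw [mem_IsNil, initW_boolPair, iterFn, boolUnpair_boolPair, iterate_roundFn]
  simp [dW, fstP, sndP]

/-- With enough coins: `⟨x, y⟩ ∈ ampLang ↔ K + 1 ≤ 2 · yesCount K`. [cite: AroraBarak2009, §7.4.1] -/
theorem boolPair_mem_ampLang_iff_le (x y : List Bool) (hy : (votes r).eval x.length + 1 ≤ y.length) :
    boolPair x y ∈ ampLang L' p r ↔
      (votes r).eval x.length + 1 ≤ 2 * yesCount L' p x y ((votes r).eval x.length) := by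
  rw [boolPair_mem_ampLang_iff, List.drop_eq_nil_iff, List.length_take, min_eq_left hy]

/-- The count over the first `i` blocks depends only on the first `i · p(|x|)` coins. [folklore] -/
theorem yesCount_take (x y : List Bool) {i N : ℕ} (hN : i * p.eval x.length ≤ N) :
    yesCount L' p x (y.take N) i = yesCount L' p x y i := by
  unfold yesCount
  congr 1
  refine filter_congr fun j hj => ?_
  have hj' : j < i := mem_range.1 hj
  have hle : j * p.eval x.length + p.eval x.length ≤ N := by
    have : (j + 1) * p.eval x.length ≤ i * p.eval x.length := Nat.mul_le_mul_right _ hj'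
    rw [Nat.succ_mul] at this; omega
  rw [List.drop_take, List.take_take, min_eq_left (by omega)]

/-- **Membership depends only on the first `coins(|x|)` coins.** [folklore] -/
theorem boolPair_mem_ampLang_iff_take (x y : List Bool) {N : ℕ} (hN : (coins p r).eval x.length ≤ N) :
    boolPair x (y.take N) ∈ ampLang L' p r ↔ boolPair x y ∈ ampLang L' p r := by
  have h1 : (votes r).eval x.length + 1 ≤ N := by rw [coins_eval] at hN; rw [votes_eval]; omega
  have h2 : (votes r).eval x.length * p.eval x.length ≤ N := by
    rw [coins_eval] at hN; rw [votes_eval]; nlinarith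
  rw [boolPair_mem_ampLang_iff, boolPair_mem_ampLang_iff, List.take_take, min_eq_left h1, yesCount_take _ _ _ h2]

/-! ### The probability of a wrong majority -/

/-- The blocks of a function on `Fin (K ℓ)`: `(e f) i j = f ⟨j + ℓ i⟩`. [folklore] -/
def blockEquiv (K ℓ : ℕ) : (Fin (K * ℓ) → Bool) ≃ (Fin K → Fin ℓ → Bool) :=
  (Equiv.arrowCongr finProdFinEquiv (Equiv.refl Bool)).symm.trans (Equiv.curry _ _ _)

/-- Evaluation of `blockEquiv`. [folklore] -/
@[simp] theorem blockEquiv_apply (K ℓ : ℕ) (f : Fin (K * ℓ) → Bool) (i : Fin K) (j : Fin ℓ) :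
    blockEquiv K ℓ f i j = f (finProdFinEquiv (i, j)) := rfl

/-- The `i`-th block of `ofFn f` is `ofFn` of the `i`-th block of `f`. [folklore] -/
theorem block_ofFn {K ℓ : ℕ} (f : Fin (K * ℓ) → Bool) (i : Fin K) :
    ((List.ofFn f).drop (i * ℓ)).take ℓ = List.ofFn (blockEquiv K ℓ f i) := by
  have hi : (i : ℕ) * ℓ + ℓ ≤ K * ℓ := by
    have := Nat.mul_le_mul_right ℓ i.isLt
    rw [Nat.succ_mul] at this; exact this
  apply List.ext_getElem
  · simp; omega
  · intro k h₁ h₂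
    simp only [List.length_ofFn] at h₂
    rw [List.getElem_take, List.getElem_drop, List.getElem_ofFn, List.getElem_ofFn, blockEquiv_apply]
    congr 1
    apply Fin.ext
    simp [finProdFinEquiv]
    ring

/-- `yesCount` of `ofFn f` counted over `Fin K`. [folklore] -/
theorem yesCount_ofFn (x : List Bool) {K : ℕ} (f : Fin (K * p.eval x.length) → Bool) :
    yesCount L' p x (List.ofFn f) K =
      (univ.filter fun i : Fin K => boolPair x (List.ofFn (blockEquiv K (p.eval x.length) f i)) ∈ L').card := by
  rw [yesCount, card_filter, card_filter, ← Fin.sum_univ_eq_sum_range]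
  refine sum_congr rfl fun i _ => ?_
  rw [block_ofFn]

/-- Chebyshev's requirement: `1/(4 δ η²) ≤ K` for `η = 1/6`, `δ = 1/(R+1)`, `K = 18 R + 19`. [folklore] -/
theorem cheb_votes (R : ℕ) : 1 / (4 * (1 / ((R : ℝ) + 1)) * (1 / 6) ^ 2) ≤ ((18 * R + 19 : ℕ) : ℝ) := by
  have hR : (0 : ℝ) ≤ R := Nat.cast_nonneg R
  rw [show (1 : ℝ) / (4 * (1 / ((R : ℝ) + 1)) * (1 / 6) ^ 2) = 9 * (R + 1) by field_simp; ring]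
  push_cast
  linarith

/-- The good-fraction hypothesis in counting form. [folklore] -/
theorem good_card_of_uniformProb {ℓ : ℕ} {E : Set (List Bool)} (h : 2 / 3 ≤ uniformProb ℓ E) :
    (1 / 2 + 1 / 6 : ℝ) * Fintype.card (Fin ℓ → Bool) ≤
      (univ.filter fun v : Fin ℓ → Bool => List.ofFn v ∈ E).card := by
  rw [uniformProb_eq_card_fun, le_div_iff₀ (by positivity)] at h
  rw [card_fun_fin_bool]
  push_cast
  linarith

/-- **A wrong majority is rare (YES side).** If each block accepts with probability `≥ 2/3`, the
counter fails to be exhausted with probability `≤ 1/(r(|x|) + 1)`. [cite: AroraBarak2009, §7.4.1 (with Chebyshev, §A.2)] -/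
theorem uniformProb_ampLang_compl_le (x : List Bool)
    (hx : 2 / 3 ≤ uniformProb (p.eval x.length) {v | boolPair x v ∈ L'}) :
    uniformProb ((coins p r).eval x.length) {y | boolPair x y ∉ ampLang L' p r} ≤ 1 / (r.eval x.length + 1) := by
  have hKN : (votes r).eval x.length + 1 ≤ (coins p r).eval x.length := by rw [coins_eval, votes_eval]; omega
  have hKℓN : (votes r).eval x.length * p.eval x.length ≤ (coins p r).eval x.length := by
    rw [coins_eval, votes_eval]; nlinarith
  generalize hK : (votes r).eval x.length = K at hKN hKℓN
  generalize hℓ : p.eval x.length = ℓ at hKℓN hx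
  generalize hN : (coins p r).eval x.length = N at hKN hKℓN
  -- the event on strings of length `N`
  have h1 : uniformProb N {y | boolPair x y ∉ ampLang L' p r} =
      uniformProb N {y | y.take (K * ℓ) ∈ {y' | 2 * yesCount L' p x y' K ≤ K}} := by
    refine uniformProb_congr fun y hy => ?_
    simp only [Set.mem_setOf_eq]
    rw [boolPair_mem_ampLang_iff_le _ _ _ _ (by rw [hy, hK]; exact hKN), hK,
      yesCount_take _ _ _ (by rw [hℓ])]
    omega
  rw [h1, uniformProb_take_of_le hKℓN, uniformProb_eq_card_fun]
  simp only [Set.mem_setOf_eq]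
  -- count over blocks
  have hf : ∀ f : Fin (K * ℓ) → Bool, yesCount L' p x (List.ofFn f) K =
      (univ.filter fun i : Fin K => boolPair x (List.ofFn (blockEquiv K ℓ f i)) ∈ L').card := by
    intro f
    have := yesCount_ofFn (L' := L') p x (K := K) (hℓ ▸ f)
    subst hℓ
    exact this
  have hcard : (univ.filter fun f : Fin (K * ℓ) → Bool => 2 * yesCount L' p x (List.ofFn f) K ≤ K).card =
      (univ.filter fun ω : Fin K → (Fin ℓ → Bool) =>
        2 * (univ.filter fun i => boolPair x (List.ofFn (ω i)) ∈ L').card ≤ K).card := by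
    refine card_equiv (blockEquiv K ℓ) fun f => ?_
    simp only [mem_filter, mem_univ, true_and]
    rw [hf]
  have hmaj := card_majority_fail_le (α := Fin ℓ → Bool) (fun v => boolPair x (List.ofFn v) ∈ L')
    (m := K) (η := 1 / 6) (δ := 1 / (((r.eval x.length : ℕ) : ℝ) + 1)) (by norm_num) (by positivity)
    (by rw [← hK, votes_eval]; exact cheb_votes (r.eval x.length)) (good_card_of_uniformProb hx)
  rw [Fintype.card_fun, Fintype.card_fin, card_fun_fin_bool, ← pow_mul, mul_comm ℓ K, ← hcard] at hmaj
  rw [div_le_iff₀ (by positivity)]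
  exact_mod_cast hmaj

/-- **A wrong majority is rare (NO side).** If each block rejects with probability `≥ 2/3`, the
counter is exhausted with probability `≤ 1/(r(|x|) + 1)`. [cite: AroraBarak2009, §7.4.1 (with Chebyshev, §A.2)] -/
theorem uniformProb_ampLang_le (x : List Bool)
    (hx : 2 / 3 ≤ uniformProb (p.eval x.length) {v | boolPair x v ∉ L'}) :
    uniformProb ((coins p r).eval x.length) {y | boolPair x y ∈ ampLang L' p r} ≤ 1 / (r.eval x.length + 1) := by
  have hKN : (votes r).eval x.length + 1 ≤ (coins p r).eval x.length := by rw [coins_eval, votes_eval]; omega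
  have hKℓN : (votes r).eval x.length * p.eval x.length ≤ (coins p r).eval x.length := by
    rw [coins_eval, votes_eval]; nlinarith
  generalize hK : (votes r).eval x.length = K at hKN hKℓN
  generalize hℓ : p.eval x.length = ℓ at hKℓN hx
  generalize hN : (coins p r).eval x.length = N at hKN hKℓN
  have h1 : uniformProb N {y | boolPair x y ∈ ampLang L' p r} =
      uniformProb N {y | y.take (K * ℓ) ∈ {y' | K + 1 ≤ 2 * yesCount L' p x y' K}} := by
    refine uniformProb_congr fun y hy => ?_
    simp only [Set.mem_setOf_eq]
    rw [boolPair_mem_ampLang_iff_le _ _ _ _ (by rw [hy, hK]; exact hKN), hK,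
      yesCount_take _ _ _ (by rw [hℓ])]
  rw [h1, uniformProb_take_of_le hKℓN, uniformProb_eq_card_fun]
  simp only [Set.mem_setOf_eq]
  have hf : ∀ f : Fin (K * ℓ) → Bool, yesCount L' p x (List.ofFn f) K =
      (univ.filter fun i : Fin K => boolPair x (List.ofFn (blockEquiv K ℓ f i)) ∈ L').card := by
    intro f
    have := yesCount_ofFn (L' := L') p x (K := K) (hℓ ▸ f)
    subst hℓ
    exact this
  -- the event implies a non-majority of rejecting blocks
  have hcard : (univ.filter fun f : Fin (K * ℓ) → Bool => K + 1 ≤ 2 * yesCount L' p x (List.ofFn f) K).card ≤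
      (univ.filter fun ω : Fin K → (Fin ℓ → Bool) =>
        2 * (univ.filter fun i => boolPair x (List.ofFn (ω i)) ∉ L').card ≤ K).card := by
    rw [← card_map (blockEquiv K ℓ).toEmbedding]
    refine card_le_card fun ω hω => ?_
    simp only [mem_map_equiv, mem_filter, mem_univ, true_and] at hω ⊢
    rw [hf, Equiv.apply_symm_apply] at hω
    have hsum : (univ.filter fun i : Fin K => boolPair x (List.ofFn (ω i)) ∈ L').card +
        (univ.filter fun i : Fin K => boolPair x (List.ofFn (ω i)) ∉ L').card = K := by
      rw [card_filter_add_card_filter_not, card_univ, Fintype.card_fin]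
    omega
  have hmaj := card_majority_fail_le (α := Fin ℓ → Bool) (fun v => boolPair x (List.ofFn v) ∉ L')
    (m := K) (η := 1 / 6) (δ := 1 / (((r.eval x.length : ℕ) : ℝ) + 1)) (by norm_num) (by positivity)
    (by rw [← hK, votes_eval]; exact cheb_votes (r.eval x.length))
    (by simpa only [Set.mem_setOf_eq] using good_card_of_uniformProb hx)
  rw [Fintype.card_fun, Fintype.card_fin, card_fun_fin_bool, ← pow_mul, mul_comm ℓ K] at hmaj
  rw [div_le_iff₀ (by positivity)]
  push_cast at hmaj
  have hcard' : ((univ.filter fun f : Fin (K * ℓ) → Bool => K + 1 ≤ 2 * yesCount L' p x (List.ofFn f) K).card : ℝ) ≤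
      (univ.filter fun ω : Fin K → (Fin ℓ → Bool) =>
        2 * (univ.filter fun i => boolPair x (List.ofFn (ω i)) ∉ L').card ≤ K).card := by exact_mod_cast hcard
  exact hcard'.trans hmaj

end PromiseAmp

/-! ### The amplification theorem -/

open PromiseAmp in
/-- **Error reduction for promise-BPP** (Goldreich 2006, Def. 2 / Arora–Barak 2009, §7.4.1):
for `Q ∈ PromiseBPP'` and every polynomial `r` there is a witness language `L'' ∈ P` with a coin
polynomial `p''` deciding `Q` with two-sided error `≤ 1/(r(|x|) + 1)` on the promise, whose verdict
depends only on the first `p''(|x|)` coins. [cite: AroraBarak2009, §7.4.1; Goldreich2006 §1.2 Def. 2] -/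
theorem PromiseProblem.exists_amplifier_of_mem_PromiseBPP' {Q : PromiseProblem} (hQ : Q ∈ PromiseBPP')
    (r : Polynomial ℕ) :
    ∃ L'' ∈ Classes.P, ∃ p'' : Polynomial ℕ,
      (∀ x ∈ Q.yes, uniformProb (p''.eval x.length) {y | boolPair x y ∉ L''} ≤ 1 / (r.eval x.length + 1)) ∧
      (∀ x ∈ Q.no, uniformProb (p''.eval x.length) {y | boolPair x y ∈ L''} ≤ 1 / (r.eval x.length + 1)) ∧
      (∀ x y : List Bool, ∀ N, p''.eval x.length ≤ N → (boolPair x (y.take N) ∈ L'' ↔ boolPair x y ∈ L'')) := by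
  obtain ⟨L', hL', p, hyes, hno⟩ := hQ
  exact ⟨ampLang L' p r, ampLang_mem_P p r hL', coins p r,
    fun x hx => uniformProb_ampLang_compl_le p r x (hyes x hx),
    fun x hx => uniformProb_ampLang_le p r x (hno x hx),
    fun x y N hN => boolPair_mem_ampLang_iff_take p r x y hN⟩

end Literature.Computability.Complexity

end
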